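import Literature.IUT.HodgeTheaters.GlobalFrobenioidsCoricModel
import HarnessLib

/-!
# [IUTchI] Example 5.1 (v): "unique up to a uniquely determined isomorphism" — what the typed
# ∞κ-coric rigidity does NOT follow from (independence witness; proof-only)

S. Mochizuki, *Inter-universal Teichmüller theory I*, kurims manuscript (May 2020), §5, Example 5.1 (v)
p. 128 ("`†ℱ^⊛` always admits an ∞κ-coric (respectively, ∞κ×-coric) structure, which is, moreover,
unique up to a uniquely determined isomorphism"; the uniqueness rests on p. 127 l.75 – p. 128 l.24:
the Kummer injection `†𝕄^⊛_∞κ ↪ lim_H H¹(H, μ_Ẑ(†𝕄^⊛_∞κ))`, `Aut(μ_Ẑ) = Ẑ^×`, and "the elementary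
observation `ℚ_{>0} ∩ Ẑ^× = {1}`" applied to divisors of zeroes and poles, Rmk 3.1.7 (i))
([IUTchI] Ex 5.1 (v) p.128) [claim: Mochizuki2012, status: disputed].  Consistency analysis of the TYPED
statements `ExistsUniqueCoricStructure` (abc-iut-L5-t1, `GlobalFrobenioidsKummer.lean`) at the MODEL
pairs `NFBridgeRecon.infκPair` / `infκxPair` and of the hypothesis `hrigid` of abc-iut-w5-d110's reduction
`existsUniqueCoricStructure_of_kummerRigid` (`GlobalFrobenioidsCoricModel.lean`); sub-DAG
`SUBDAG-IUTchI-Ex51.md` rows E51/L27 (b), E51/L29.  No IUT content is asserted; no side is taken.  This is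
the NF-side sibling of the Θ-side analysis `ThetaPMEllGluingRigidity*.lean` ([IUTchI] Rmk 6.12.2 (ii)
cites Prop 4.8 (ii) AND Cor 5.6 (ii); the latter's rigidity descends from Example 5.1 (v)).

## What is proved (theorems only; all hypotheses inline)

1. **One row, not two.** For ANY Kummer realisation `κ` of a pair, w5-d110's hypothesis
   "every automorphism of the pair is `κ`-compatible" is EQUIVALENT to `Subsingleton (Iso model model)`
   (`CoricPair.kummerRigid_iff_subsingleton_iso`), hence to the uniqueness field of
   `ExistsUniqueCoricStructure` (`existsUniqueCoricStructure_iff_kummerRigid`): the reduction is a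
   rephrasing; rows L27 (b)-as-`hrigid` and L29 are the same obligation.
2. **Independence.** There is an instance `N` of abc-iut-L5-t1's Example 5.1 (i) interface
   `NFBridgeRecon` — trivial Galois actions, `𝕄^⊛_κ = 𝕄^⊛_∞κ = 𝕄^⊛_∞κ× := ℂ ∖ {0}` (a divisible,
   cyclotomic pseudo-monoid), satisfying the (i) predicates `MκIsInvariants`, `ConstantsInfκx` — whose
   model ∞κ-pair carries the NON-TRIVIAL automorphism `f ↦ f⁻¹` (equivariant, multiplicative, bijective):
   so `ExistsUniqueCoricStructure N.piRat N.infκPair` and `… N.infκxPair` FAIL, w5-d110's `hrigid` fails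
   for EVERY Kummer realisation of that pair, and the pair does have a Kummer realisation (in `ℂ^×`;
   non-vacuity) — `NFBridgeRecon.exists_recon_not_existsUniqueCoricStructure`,
   `not_forall_recon_existsUniqueCoricStructure`.
3. **Reading.** The typed "unique up to a uniquely determined isomorphism" is therefore NOT derivable
   from the interface plus Kummer realisations; the load-bearing inputs of the printed argument are
   (a) the NATURALITY of the Kummer map under automorphisms of the pair (`κ ∘ e = u_e · κ` with
   `u_e ∈ Aut(μ_Ẑ(𝕄)) = Ẑ^×` — the typed `KummerRealization` is free data, no such law) and (b) cyclotomic
   rigidity `u_e = 1` ("`ℚ_{>0} ∩ Ẑ^× = {1}`" via divisors, Rmk 3.1.7 (i)) — which in the model EXCLUDES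
   `f ↦ f⁻¹` (Rmk 3.1.7 (i) p. 67: a non-constant κ-coric function "has precisely one pole … but at least
   two distinct zeroes", so "it is never the case that both `f` and `f⁻¹` are κ-coric") — laws on the
   coric sets `𝕄^⊛_∞κ ⊆ K^rat` that the Example-5.1 (i) interface does not carry and the §3/§5 merge must
   supply.

Proof-only: no `def`, no new `Prop` fact; every object is built inside the proofs. typed ≠ proved.
-/

namespace Literature.IUT.HodgeTheaters

open Pointwise

universe u

/-! ### 1. w5-d110's Kummer-rigidity hypothesis is equivalent to rigidity of the pair -/

section Equivalence

variable {Γ : Type u} [Group Γ] [TopologicalSpace Γ]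

/-- For ANY Kummer realisation `κ` of a pair (injective by definition), "every automorphism of the pair
is compatible with `κ`" ([IUTchI] Ex 5.1 (v) p. 128, the form of abc-iut-w5-d110's hypothesis `hrigid`)
holds iff the pair has no automorphism other than the identity.  So the reduction
`existsUniqueCoricStructure_of_kummerRigid` neither weakens nor strengthens the uniqueness clause.
([IUTchI] Ex 5.1 (v) p.128) [claim: Mochizuki2012, status: disputed] -/
theorem CoricPair.kummerRigid_iff_subsingleton_iso {P : CoricPair Γ} {H : Type u} [CommGroup H]
    [MulAction Γ H] (κ : P.KummerRealization H) :
    (∀ e : CoricPair.Iso P P, e.IsCompatible κ κ) ↔ Subsingleton (CoricPair.Iso P P) := by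
  constructor
  · exact fun h => ⟨fun e e' => CoricPair.Iso.eq_of_isCompatible (h e) (h e')⟩
  · intro h e x
    rw [h.elim e (CoricPair.Iso.refl P)]
    rfl

/-- **Ex. 5.1 (v), p. 128, typed uniqueness ⟺ Kummer rigidity.** Relative to any Kummer realisation `κ`
of the model pair, abc-iut-L5-t1's `ExistsUniqueCoricStructure Γ model` (existence — always, the model
itself — plus rigidity of the model pair) is EQUIVALENT to "every automorphism of the model pair is
`κ`-compatible" (sub-DAG rows E51/L27 (b)-as-hypothesis and E51/L29 coincide).
([IUTchI] Ex 5.1 (v) p.128) [claim: Mochizuki2012, status: disputed] -/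
theorem existsUniqueCoricStructure_iff_kummerRigid {model : CoricPair Γ} {H : Type u} [CommGroup H]
    [MulAction Γ H] (κ : model.KummerRealization H) :
    ExistsUniqueCoricStructure Γ model ↔ ∀ e : CoricPair.Iso model model, e.IsCompatible κ κ := by
  rw [CoricPair.kummerRigid_iff_subsingleton_iso κ, existsUniqueCoricStructure_iff]
  exact ⟨fun h => h.2, fun h => ⟨exists_coricStructure Γ model, h⟩⟩

end Equivalence

/-! ### 2. The independence witness: an Example-5.1 (i) interface whose model pairs are not rigid -/

namespace NFBridgeRecon

/-- **Ex. 5.1 (v) p. 128 "unique up to a uniquely determined isomorphism" is NOT derivable from the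
Example-5.1 (i) interface.**  There is an `NFBridgeRecon` (trivial Galois actions on `F̄ := ℂ =: K^rat`,
all three coric sets `:= ℂ ∖ {0}`), satisfying the (i) predicates `MκIsInvariants` and `ConstantsInfκx`,
such that: the typed uniqueness `ExistsUniqueCoricStructure` FAILS at both model pairs (`∞κ` and `∞κ×`)
— the model pair has the non-trivial automorphism `f ↦ f⁻¹`; the model ∞κ-pair HAS a Kummer realisation
(in `ℂ^×` with the trivial action: the situation of p. 127 is not vacuous); and for EVERY container `H`
and EVERY Kummer realisation `κ` of the model ∞κ-pair some automorphism is NOT `κ`-compatible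
(abc-iut-w5-d110's hypothesis `hrigid` fails).  The printed inputs that exclude this witness — naturality
of the Kummer map under automorphisms of the pair and "`ℚ_{>0} ∩ Ẑ^× = {1}`" on divisors of κ-coric
functions (Rmk 3.1.7 (i) p. 67: "it is never the case that both `f` and `f⁻¹` are κ-coric") — are not
carried by the interface.
([IUTchI] Ex 5.1 (v) p.128) [claim: Mochizuki2012, status: disputed] -/
theorem exists_recon_not_existsUniqueCoricStructure : ∃ N : NFBridgeRecon.{0},
    N.MκIsInvariants ∧ N.ConstantsInfκx ∧
    ¬ ExistsUniqueCoricStructure N.piRat N.infκPair ∧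
    ¬ ExistsUniqueCoricStructure N.piRat N.infκxPair ∧
    (∃ (H : Type) (_ : CommGroup H) (_ : MulAction N.piRat H),
      Nonempty (N.infκPair.KummerRealization H)) ∧
    ∀ (H : Type) [CommGroup H] [MulAction N.piRat H] (κ : N.infκPair.KummerRealization H),
      ¬ ∀ e : CoricPair.Iso N.infκPair N.infκPair, e.IsCompatible κ κ := by
  let G0 : ProfiniteGrp.{0} := ProfiniteGrp.of PUnit.{1}
  letI tr : MulSemiringAction G0 ℂ :=
    { smul := fun _ x => x, one_smul := fun _ => rfl, mul_smul := fun _ _ _ => rfl,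
      smul_zero := fun _ => rfl, smul_add := fun _ _ _ => rfl, smul_one := fun _ => rfl,
      smul_mul := fun _ _ _ => rfl }
  have hstab : ∀ x : ℂ, IsOpen (MulAction.stabilizer G0 x : Set G0) := fun x => by
    have : (MulAction.stabilizer G0 x : Set G0) = Set.univ :=
      Set.eq_univ_of_forall fun g => MulAction.mem_stabilizer_iff.mpr rfl
    rw [this]; exact isOpen_univ
  -- the interface instance: everything trivial, the coric sets as large as possible
  let N0 : NFBridgeRecon.{0} :=
    { l := 5, piDast := G0, piDcirc := ⊤, Fbar := ℂ, fbarField := inferInstance, fbarAction := tr,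
      isOpen_stabilizer_fbar := hstab, piRat := G0, ratToAst := ContinuousMonoidHom.id G0,
      ratToAst_surjective := Function.surjective_id, Krat := ℂ, kratField := inferInstance,
      kratAction := tr, isOpen_stabilizer_krat := hstab, const := RingHom.id ℂ,
      const_smul := fun _ _ => rfl, Mκ := {f | f ≠ 0}, Minfκ := {f | f ≠ 0}, Minfκx := {f | f ≠ 0},
      mκ_subset := subset_rfl, minfκ_subset := subset_rfl, zero_notMem := fun h => h rfl,
      smul_mem_minfκ := fun _ _ hf => hf, smul_mem_minfκx := fun _ _ hf => hf, solKer := ⊥,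
      solKer_normal := inferInstance, AutD := PUnit, autGroup := inferInstance, Autε := ⊤, AutSL := ⊤,
      AutSLε := ⊤, autSLε_le := le_rfl, autSLε_le_autε := le_rfl,
      lift := fun _ => ContinuousMulEquiv.refl G0 }
  -- the inversion automorphism `f ↦ f⁻¹` of the model pair (the ∞κ- and ∞κ×-pairs coincide here)
  have hmem : ∀ x : N0.infκPair.carrier, (x : ℂ) ≠ 0 := fun x => x.2
  let ι : N0.infκPair.carrier → N0.infκPair.carrier := fun x => ⟨(x : ℂ)⁻¹, inv_ne_zero (hmem x)⟩
  have hιι : ∀ x, ι (ι x) = x := fun x => Subtype.ext (inv_inv (x : ℂ))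
  let e : CoricPair.Iso N0.infκPair N0.infκPair :=
    { toEquiv := ⟨ι, ι, hιι, hιι⟩
      smul := fun _ _ => rfl
      dom := fun p => by
        change (p.1 : ℂ) * p.2 ≠ 0 ↔ ((p.1 : ℂ)⁻¹) * (p.2 : ℂ)⁻¹ ≠ 0
        exact iff_of_true (mul_ne_zero (hmem p.1) (hmem p.2))
          (mul_ne_zero (inv_ne_zero (hmem p.1)) (inv_ne_zero (hmem p.2)))
      op := fun p => Subtype.ext (mul_inv (p.1.1 : ℂ) p.1.2) }
  -- it is not the identity: it moves `2`
  have hne : e ≠ CoricPair.Iso.refl N0.infκPair := by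
    intro he
    have h2 : ((e.toEquiv ⟨(2 : ℂ), two_ne_zero⟩ : N0.infκPair.carrier) : ℂ) = 2 := by
      rw [he]; rfl
    have h2' : ((e.toEquiv ⟨(2 : ℂ), two_ne_zero⟩ : N0.infκPair.carrier) : ℂ) = (2 : ℂ)⁻¹ := rfl
    rw [h2'] at h2
    norm_num at h2
  have hns : ¬ Subsingleton (CoricPair.Iso N0.infκPair N0.infκPair) := fun hs => hne (hs.elim _ _)
  -- a Kummer realisation of the model pair in `ℂ^×` (trivial action)
  letI ta : MulAction G0 ℂˣ :=
    { smul := fun _ z => z, one_smul := fun _ => rfl, mul_smul := fun _ _ _ => rfl }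
  let κ0 : N0.infκPair.KummerRealization ℂˣ :=
    { toFun := fun x => Units.mk0 (x : ℂ) (hmem x)
      realizes :=
        { injective := fun x y hxy => Subtype.ext (by simpa [Units.mk0] using congrArg Units.val hxy)
          dom_eq := by
            ext p
            change (p.1 : ℂ) * p.2 ≠ 0 ↔ _
            constructor
            · intro hp
              exact ⟨⟨(p.1 : ℂ) * p.2, hp⟩, Units.ext (by simp)⟩
            · intro _
              exact mul_ne_zero (hmem p.1) (hmem p.2)
          op_eq := fun p => Units.ext (by simp) }
      smul := fun _ _ => rfl }
  refine ⟨N0, ⟨?_⟩, ⟨fun x => x.ne_zero⟩, fun h => hns h.subsingleton_iso, fun h => hns h.subsingleton_iso,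
    ⟨ℂˣ, inferInstance, ta, ⟨κ0⟩⟩, fun H _ _ κ hrig => hns ?_⟩
  · -- `𝕄_κ` is the set of invariants of `𝕄_∞κ` (trivial action)
    ext f
    exact ⟨fun hf => ⟨hf, fun _ => rfl⟩, fun hf => hf.1⟩
  · exact (CoricPair.kummerRigid_iff_subsingleton_iso κ).mp hrig

/-- **Corollary.** The typed Ex 5.1 (v) uniqueness at the model ∞κ-pair is not a theorem about the
interface: `¬ ∀ N, ExistsUniqueCoricStructure N.piRat N.infκPair` (likewise for `∞κ×`).
([IUTchI] Ex 5.1 (v) p.128) [claim: Mochizuki2012, status: disputed] -/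
theorem not_forall_recon_existsUniqueCoricStructure :
    (¬ ∀ N : NFBridgeRecon.{0}, ExistsUniqueCoricStructure N.piRat N.infκPair) ∧
      ¬ ∀ N : NFBridgeRecon.{0}, ExistsUniqueCoricStructure N.piRat N.infκxPair := by
  obtain ⟨N, -, -, h₁, h₂, -, -⟩ := exists_recon_not_existsUniqueCoricStructure
  exact ⟨fun h => h₁ (h N), fun h => h₂ (h N)⟩

end NFBridgeRecon

end Literature.IUT.HodgeTheaters
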